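import Literature.MathematicalPhysics.QuantumManyBody.PeriodicMaxFormSimplicity
import HarnessLib

/-!
# The cell integral of the truncation excess of an integrable pair profile vanishes
# (line `third-law-current-floor`, crux `HardCoreExtension`, stmt-AtomisticToContinuum-11786; node I2 of the
# (α'_int) plan)

For an admissible pair profile `v` with `∫_{ℝ³} v(|x|) dx < ∞`, every particle number `N` and every side
`L > 0`, the cell integral of the periodic interaction of the truncation excess
`eₙ = v − min(v, n) = (v − n)₊` tends to zero:
`∫_{[0,L)^{3N}} ∑_{i<j} eₙ^per(xᵢ − xⱼ) dX → 0` as `n → ∞` (`stub_interactionExcess_tendsto_zero`).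

Proof. Splitting off the first particle (`periodicInteraction_succ`, `lintegral_cellN_succ`) and unfolding
the periodisation in that particle (`lintegral_cell_periodizedPotential_sub`) gives the recursion
`∫_{cell^{m+1}} W_w = m · (∫_{ℝ³} w(|y|) dy) · L^{3m} + (∫_{cell^m} W_w) · L³` for every measurable profile
`w` (`InteractionExcess.lintegral_cellN_succ_periodicInteraction`, the computation of
`lintegral_cellN_periodicInteraction_ne_top_of_lintegral_ne_top` as an identity), whence the claim by
induction on `N` once `∫_{ℝ³} eₙ(|y|) dy → 0`; the latter is dominated convergence (`eₙ ≤ v`, and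
`eₙ(|y|) = 0` as soon as `n ≥ v(|y|)`, which happens eventually for a.e. `y` since `v(|y|) < ∞` a.e. by
integrability). [folklore]
-/

noncomputable section

namespace Summit.AtomisticToContinuum.BoseEinsteinCondensation.Cruxes.HardCoreExtension.ThirdLawCurrentFloor

open MeasureTheory Filter
open scoped ENNReal NNReal BigOperators Topology
open Literature.MathematicalPhysics.QuantumManyBody.BoseGas
open Literature.MathematicalPhysics.QuantumManyBody

namespace InteractionExcess

variable {N : ℕ} {L : ℝ} {w : ℝ → ℝ≥0∞}

/-- The periodic interaction of a measurable profile is measurable (copy of the private lemma of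
`PeriodicMaxFormSimplicity.lean`). [folklore] -/
theorem measurable_periodicInteraction_excess (hw : Measurable w) (L : ℝ) :
    Measurable (periodicInteraction (N := N) w L) := by
  unfold periodicInteraction periodizedPotential
  refine Finset.measurable_sum _ fun i _ => Finset.measurable_sum _ fun j _ => ?_
  exact (Measurable.tsum fun n => hw.comp (measurable_id.sub_const _).norm).comp
    ((measurable_config_apply i).sub (measurable_config_apply j))

/-- `x ↦ w^per(x - y)` is measurable. [folklore] -/
theorem measurable_periodizedPotential_sub_excess (hw : Measurable w) (L : ℝ) (y : Space) :
    Measurable fun x : Space => periodizedPotential w L (x - y) := by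
  unfold periodizedPotential
  exact (Measurable.tsum fun n => hw.comp (measurable_id.sub_const _).norm).comp
    (measurable_id.sub_const y)

/-- **First-particle recursion for the cell integral of the pair interaction**: for `L > 0` and a
measurable profile `w`,
`∫_{cell^{m+1}} W_w = m · (∫_{ℝ³} w(|y|) dy) · L^{3m} + (∫_{cell^m} W_w) · L³`
(Tonelli in the first particle, `∑_{i<j} = ∑_{0<j} + ∑_{1≤i<j}`, and the tiling identity
`∫_{[0,L)³} w^per(x - y) dx = ∫_{ℝ³} w(|z|) dz`). [folklore] -/
theorem lintegral_cellN_succ_periodicInteraction (hL : 0 < L) (hw : Measurable w) (m : ℕ) :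
    ∫⁻ X in cellN (m + 1) L, periodicInteraction w L X =
      (m : ℝ≥0∞) * (∫⁻ z : Space, w ‖z‖) * (ENNReal.ofReal L ^ 3) ^ m +
        (∫⁻ Y in cellN m L, periodicInteraction w L Y) * ENNReal.ofReal L ^ 3 := by
  have hinner : ∀ Y : Config m, ∫⁻ x in cell L, periodicInteraction w L (Matrix.vecCons x Y) =
      (m : ℝ≥0∞) * (∫⁻ z : Space, w ‖z‖) + periodicInteraction w L Y * ENNReal.ofReal L ^ 3 := by
    intro Y
    have hfun : (fun x : Space => periodicInteraction w L (Matrix.vecCons x Y)) =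
        fun x => (∑ j : Fin m, periodizedPotential w L (x - Y j)) + periodicInteraction w L Y := by
      funext x
      rw [periodicInteraction_succ]
      simp only [Matrix.cons_val_zero, Matrix.cons_val_succ, Matrix.tail_cons]
    rw [hfun, lintegral_add_right _ measurable_const,
      lintegral_finsetSum _ (fun j _ => measurable_periodizedPotential_sub_excess hw L (Y j)),
      setLIntegral_const, volume_cell]
    simp only [lintegral_cell_periodizedPotential_sub hL hw, Finset.sum_const, Finset.card_univ,
      Fintype.card_fin, nsmul_eq_mul]
  rw [lintegral_cellN_succ L (measurable_periodicInteraction_excess hw L)]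
  simp only [hinner]
  rw [lintegral_add_left measurable_const, setLIntegral_const, volume_cellN,
    lintegral_mul_const _ (measurable_periodicInteraction_excess hw L)]

/-- There is no pair interaction without particles: `∫_{cell^0} W_w = 0`. [folklore] -/
theorem lintegral_cellN_zero_periodicInteraction (w : ℝ → ℝ≥0∞) (L : ℝ) :
    ∫⁻ X in cellN 0 L, periodicInteraction w L X = 0 := by
  have h0 : ∀ X : Config 0, periodicInteraction w L X = 0 := fun X => by simp [periodicInteraction]
  simp [h0]

/-- **Dominated convergence for the truncation excess**: `∫_{ℝ³} (v(|y|) − min(v(|y|), n)) dy → 0` as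
`n → ∞` for measurable `v` with `∫_{ℝ³} v(|y|) dy < ∞` (the integrand is dominated by `v(|y|)` and
vanishes as soon as `n ≥ v(|y|)`, i.e. eventually for a.e. `y`). [folklore] -/
theorem tendsto_lintegral_excess_zero {v : ℝ → ℝ≥0∞} (hv : Measurable v)
    (hint : (∫⁻ x : Space, v ‖x‖) ≠ ⊤) :
    Tendsto (fun n : ℕ => ∫⁻ y : Space, (v ‖y‖ - min (v ‖y‖) (n : ℝ≥0∞))) atTop (𝓝 0) := by
  have hvn : Measurable fun y : Space => v ‖y‖ := hv.comp measurable_norm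
  have hmeas : ∀ n : ℕ, Measurable fun y : Space => v ‖y‖ - min (v ‖y‖) (n : ℝ≥0∞) := fun n =>
    hvn.sub (hvn.min measurable_const)
  have h := tendsto_lintegral_of_dominated_convergence (μ := (volume : Measure Space))
    (F := fun (n : ℕ) (y : Space) => v ‖y‖ - min (v ‖y‖) (n : ℝ≥0∞)) (f := fun _ => 0)
    (fun y => v ‖y‖) hmeas (fun n => Eventually.of_forall fun y => tsub_le_self) hint ?_
  · simpa only [lintegral_zero] using h
  · filter_upwards [ae_lt_top (f := fun y : Space => v ‖y‖) hvn hint] with y hy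
    obtain ⟨n₀, hn₀⟩ := ENNReal.exists_nat_gt hy.ne
    refine tendsto_const_nhds.congr' ?_
    filter_upwards [eventually_ge_atTop n₀] with n hn
    have hle : v ‖y‖ ≤ (n : ℝ≥0∞) := hn₀.le.trans (by exact_mod_cast hn)
    rw [min_eq_left hle, tsub_self]

end InteractionExcess

open InteractionExcess

/-- **I2 `stub_interactionExcess_tendsto_zero`** (the cell integral of the truncation excess of an
INTEGRABLE profile vanishes). For admissible `v` with `∫_{ℝ³} v(|x|) dx < ∞`, every `N` and `L > 0`:
`∫_{[0,L)^{3N}} ∑_{i<j} (v − min(v,n))^per(xᵢ − xⱼ) dX → 0` as `n → ∞` (induction on `N` through the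
first-particle recursion `InteractionExcess.lintegral_cellN_succ_periodicInteraction`, i.e. the tiling
identity `lintegral_cell_periodizedPotential_sub`; dominated convergence
`InteractionExcess.tendsto_lintegral_excess_zero` for `y ↦ (v(|y|) − n)₊ ≤ v(|y|)`, which tends to `0`
wherever `v(|y|) < ⊤`, i.e. a.e. by integrability). [folklore] -/
theorem stub_interactionExcess_tendsto_zero :
    ∀ v : ℝ → ℝ≥0∞, IsRepulsiveFiniteRange v → (∫⁻ x : Space, v ‖x‖) ≠ ⊤ →
      ∀ (N : ℕ) (L : ℝ), 0 < L →
        Tendsto (fun n : ℕ => ∫⁻ X in cellN N L,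
          periodicInteraction (fun r => v r - min (v r) (n : ℝ≥0∞)) L X) atTop (𝓝 0) := by
  intro v hv hint N L hL
  have hmeas : ∀ n : ℕ, Measurable fun r => v r - min (v r) (n : ℝ≥0∞) := fun n =>
    hv.1.sub (hv.1.min measurable_const)
  have hI := tendsto_lintegral_excess_zero hv.1 hint
  induction N with
  | zero =>
    simp only [lintegral_cellN_zero_periodicInteraction]
    exact tendsto_const_nhds
  | succ m ih =>
    have h1 : Tendsto (fun n : ℕ => (m : ℝ≥0∞) * (∫⁻ z : Space, (v ‖z‖ - min (v ‖z‖) (n : ℝ≥0∞))) *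
        (ENNReal.ofReal L ^ 3) ^ m) atTop (𝓝 0) := by
      have h : Tendsto (fun n : ℕ => (m : ℝ≥0∞) * (∫⁻ z : Space, (v ‖z‖ - min (v ‖z‖) (n : ℝ≥0∞))) *
          (ENNReal.ofReal L ^ 3) ^ m) atTop (𝓝 ((m : ℝ≥0∞) * 0 * (ENNReal.ofReal L ^ 3) ^ m)) :=
        ENNReal.Tendsto.mul_const
          (ENNReal.Tendsto.const_mul hI (Or.inr (ENNReal.natCast_ne_top m)))
          (Or.inr (ENNReal.pow_ne_top (ENNReal.pow_ne_top ENNReal.ofReal_ne_top)))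
      simpa only [mul_zero, zero_mul] using h
    have h2 : Tendsto (fun n : ℕ => (∫⁻ Y in cellN m L,
        periodicInteraction (fun r => v r - min (v r) (n : ℝ≥0∞)) L Y) * ENNReal.ofReal L ^ 3)
        atTop (𝓝 0) := by
      have h : Tendsto (fun n : ℕ => (∫⁻ Y in cellN m L,
          periodicInteraction (fun r => v r - min (v r) (n : ℝ≥0∞)) L Y) * ENNReal.ofReal L ^ 3)
          atTop (𝓝 (0 * ENNReal.ofReal L ^ 3)) :=
        ENNReal.Tendsto.mul_const ih (Or.inr (ENNReal.pow_ne_top ENNReal.ofReal_ne_top))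
      simpa only [zero_mul] using h
    have h12 := h1.add h2
    rw [add_zero] at h12
    exact h12.congr fun n => (lintegral_cellN_succ_periodicInteraction hL (hmeas n) m).symm

end Summit.AtomisticToContinuum.BoseEinsteinCondensation.Cruxes.HardCoreExtension.ThirdLawCurrentFloor

end
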